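import Mathlib
import HarnessLib
import Literature.NumberTheory.LFunctions.ZetaScrew
import Literature.NumberTheory.LFunctions.ZetaScrewThm41Proofs
import Summits.RiemannHypothesis.RiemannHypothesis.Theorems.IntegerScrewHingeCovariance

/-!
# Route `IntegerScrew` — FAR DECORRELATION of the increments at non-integer ratios
# (the third leg of the order-`1/M` covariance structure; PIVOT-LAW §15.13; RH-FREE)

`IntegerScrewIncrementCovLag` (neighbours: `M·Cov(I_M, I_{M−k}) → c_k/2`) and
`IntegerScrewHingeCovariance` (divisor ratios: `M·Cov(I_M, I_{⌈M/n⌉}) → −Λ(n)/√n`) are complemented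
here by: at a fixed NON-INTEGER ratio the increments decorrelate at order `1/M`.  We take the
cleanest family of non-integer ratios, `α = N + ½` exactly: `M = (2N+1)·r` against the node `m = 2r`:

* `tendsto_farCov_half` : for every `N ≥ 1`, as `r → ∞`,
  `M·(Ψ(log(M/(m−1))) + Ψ(log((M−1)/m)) − Ψ(log(M/m)) − Ψ(log((M−1)/(m−1)))) → 0`
  with `M = (2N+1)·r`, `m = 2r` — the lag cell sits inside the open gap `(log N, log(N+1))` of `φ`,
  where `φ` is affine (exact cancellation) and `Ψ_wall` contributes `o(1/M)`
  (`IntegerScrewHingeCovariance.wallPsi_mixed_le`).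

So at order `1/M`: neighbours resonate with the universal profile, divisor-type nodes with `−Λ/√·`, and a
generic far node not at all.  Nothing here bears on the truth of RH. [Suzuki2023, (1.1)]
-/

noncomputable section

-- D-0017: `Summit.<S>.<S>.…` is the designed namespace of a single-problem summit.
set_option linter.dupNamespace false

namespace Summit.RiemannHypothesis.RiemannHypothesis.Theorems.IntegerScrew

open Literature.NumberTheory.LFunctions Literature.NumberTheory.LFunctions.Suzuki2023Thm41
open Filter Set Finset
open scoped Topology

/-- On a lag cell inside ONE gap of `φ` the prime-sum part of the mixed difference vanishes exactly:
if all four points lie in `[log N, log(N+1)]` (`N ≥ 1`) and `P₁ + P₂ = P₃ + P₄` then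
`φ(P₁) + φ(P₂) − φ(P₃) − φ(P₄) = 0`. [folklore] -/
theorem primeSum_mixed_eq_zero_of_gap {N : ℕ} (hN : 1 ≤ N) {P1 P2 P3 P4 : ℝ}
    (h1 : Real.log N ≤ P1 ∧ P1 ≤ Real.log (N + 1)) (h2 : Real.log N ≤ P2 ∧ P2 ≤ Real.log (N + 1))
    (h3 : Real.log N ≤ P3 ∧ P3 ≤ Real.log (N + 1)) (h4 : Real.log N ≤ P4 ∧ P4 ≤ Real.log (N + 1))
    (hsum : P1 + P2 = P3 + P4) :
    zetaScrewPrimeSum P1 + zetaScrewPrimeSum P2 - zetaScrewPrimeSum P3 - zetaScrewPrimeSum P4 = 0 := by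
  rw [zetaScrewPrimeSum_eq_of_mem_Icc hN h1.1 h1.2, zetaScrewPrimeSum_eq_of_mem_Icc hN h2.1 h2.2,
    zetaScrewPrimeSum_eq_of_mem_Icc hN h3.1 h3.2, zetaScrewPrimeSum_eq_of_mem_Icc hN h4.1 h4.2,
    ← Finset.sum_add_distrib, ← Finset.sum_sub_distrib, ← Finset.sum_sub_distrib]
  refine Finset.sum_eq_zero fun m _ => ?_
  have : P1 - Real.log m + (P2 - Real.log m) - (P3 - Real.log m) - (P4 - Real.log m)
      = (P1 + P2) - (P3 + P4) := by ring
  rw [← mul_add, ← mul_sub, ← mul_sub, this, hsum, sub_self, mul_zero]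

/-- **FAR DECORRELATION AT THE HALF-INTEGER RATIO `N + ½`.**  For every `N ≥ 1`, with `M = (2N+1)·r`
and the node `m = 2r` (`M/m = N + ½`), as `r → ∞`:
`M·(Ψ(log(M/(m−1))) + Ψ(log((M−1)/m)) − Ψ(log(M/m)) − Ψ(log((M−1)/(m−1)))) → 0`,
i.e. `M·Cov(I_M, I_m) → 0`. [folklore] -/
theorem tendsto_farCov_half {N : ℕ} (hN : 1 ≤ N) :
    Tendsto (fun r : ℕ => ((2 * (N : ℝ) + 1) * r) *
        (zetaScrew (Real.log (((2 * (N : ℝ) + 1) * r) / (2 * (r : ℝ) - 1)))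
          + zetaScrew (Real.log (((2 * (N : ℝ) + 1) * r - 1) / (2 * (r : ℝ))))
          - zetaScrew (Real.log (((2 * (N : ℝ) + 1) * r) / (2 * (r : ℝ))))
          - zetaScrew (Real.log (((2 * (N : ℝ) + 1) * r - 1) / (2 * (r : ℝ) - 1)))))
      atTop (𝓝 0) := by
  set ℓ : ℝ := Real.log ((N : ℝ) + 1 / 2) with hℓ
  have hN' : (1 : ℝ) ≤ N := by exact_mod_cast hN
  have hℓ0 : 0 < ℓ := Real.log_pos (by linarith)
  rw [Metric.tendsto_atTop]
  intro ε hε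
  obtain ⟨δ, hδ, hδW⟩ := wallPsi_mixed_le hℓ0 (show 0 < ε / (4 * (2 * N + 1)) by positivity)
  have hsmall : ∀ᶠ r : ℕ in atTop, (1 : ℝ) / (r : ℝ) ≤ δ ∧ (4 : ℝ) * N + 4 ≤ r := by
    have h1 : Tendsto (fun r : ℕ => (1 : ℝ) / (r : ℝ)) atTop (𝓝 0) :=
      tendsto_const_nhds.div_atTop tendsto_natCast_atTop_atTop
    filter_upwards [h1.eventually (gt_mem_nhds hδ), eventually_ge_atTop (4 * N + 4)] with r h hr
    exact ⟨h.le, by exact_mod_cast hr⟩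
  obtain ⟨R, hR⟩ := eventually_atTop.1 hsmall
  refine ⟨R, fun r hr => ?_⟩
  obtain ⟨hrδ, hrN⟩ := hR r hr
  have hr0 : 0 < (r : ℝ) := by linarith
  have hm1 : 0 < 2 * (r : ℝ) - 1 := by linarith
  have hm0 : 0 < 2 * (r : ℝ) := by linarith
  have hM1 : 0 < (2 * (N : ℝ) + 1) * r - 1 := by nlinarith
  have hM0 : 0 < (2 * (N : ℝ) + 1) * r := by positivity
  -- base point x = log(M/m) = ℓ exactly; a = log(m/(m−1)), b = log(M/(M−1))
  set a : ℝ := Real.log ((2 * (r : ℝ)) / (2 * (r : ℝ) - 1)) with ha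
  set b : ℝ := Real.log (((2 * (N : ℝ) + 1) * r) / ((2 * (N : ℝ) + 1) * r - 1)) with hb
  have hx : Real.log (((2 * (N : ℝ) + 1) * r) / (2 * (r : ℝ))) = ℓ := by
    rw [hℓ]; congr 1; field_simp
  have ha0 : 0 ≤ a := Real.log_nonneg (by rw [le_div_iff₀ hm1]; linarith)
  have hale : a ≤ 1 / (r : ℝ) := by
    have := Real.log_le_sub_one_of_pos (show 0 < (2 * (r : ℝ)) / (2 * (r : ℝ) - 1) by positivity)
    have e : (2 * (r : ℝ)) / (2 * (r : ℝ) - 1) - 1 = 1 / (2 * (r : ℝ) - 1) := by field_simp; ring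
    have hmono : 1 / (2 * (r : ℝ) - 1) ≤ 1 / (r : ℝ) := one_div_le_one_div_of_le hr0 (by linarith)
    linarith
  have hb0 : 0 ≤ b := Real.log_nonneg (by rw [le_div_iff₀ hM1]; linarith)
  have hble : b ≤ 1 / (r : ℝ) := by
    have := Real.log_le_sub_one_of_pos
      (show 0 < ((2 * (N : ℝ) + 1) * r) / ((2 * (N : ℝ) + 1) * r - 1) by positivity)
    have e : ((2 * (N : ℝ) + 1) * r) / ((2 * (N : ℝ) + 1) * r - 1) - 1
        = 1 / ((2 * (N : ℝ) + 1) * r - 1) := by field_simp; ring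
    have hmono : 1 / ((2 * (N : ℝ) + 1) * r - 1) ≤ 1 / (r : ℝ) :=
      one_div_le_one_div_of_le hr0 (by nlinarith)
    linarith
  have e1 : Real.log (((2 * (N : ℝ) + 1) * r) / (2 * (r : ℝ) - 1)) = ℓ + a := by
    rw [← hx, ha, Real.log_div hM0.ne' hm1.ne', Real.log_div hM0.ne' hm0.ne',
      Real.log_div hm0.ne' hm1.ne']
    ring
  have e2 : Real.log (((2 * (N : ℝ) + 1) * r - 1) / (2 * (r : ℝ))) = ℓ - b := by
    rw [← hx, hb, Real.log_div hM1.ne' hm0.ne', Real.log_div hM0.ne' hm0.ne',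
      Real.log_div hM0.ne' hM1.ne']
    ring
  have e4 : Real.log (((2 * (N : ℝ) + 1) * r - 1) / (2 * (r : ℝ) - 1)) = ℓ + a - b := by
    rw [← hx, ha, hb, Real.log_div hM1.ne' hm1.ne', Real.log_div hM0.ne' hm0.ne',
      Real.log_div hm0.ne' hm1.ne', Real.log_div hM0.ne' hM1.ne']
    ring
  -- the φ-part vanishes: all four points in the gap [log N, log(N+1)]
  have hgap : ∀ y : ℝ, ℓ - b ≤ y → y ≤ ℓ + a → Real.log N ≤ y ∧ y ≤ Real.log (N + 1) := by
    intro y hy1 hy2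
    constructor
    · -- log N ≤ ℓ − b ⟸ N ≤ (M−1)/m
      have : Real.log (N : ℝ) ≤ ℓ - b := by
        rw [← e2]; apply Real.log_le_log (by linarith)
        rw [le_div_iff₀ hm0]; nlinarith
      linarith
    · have : ℓ + a ≤ Real.log ((N : ℝ) + 1) := by
        rw [← e1]; apply Real.log_le_log (by positivity)
        rw [div_le_iff₀ hm1]; nlinarith
      linarith
  have hφ : zetaScrewPrimeSum (ℓ + a) + zetaScrewPrimeSum (ℓ - b) - zetaScrewPrimeSum ℓ
      - zetaScrewPrimeSum (ℓ + a - b) = 0 :=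
    primeSum_mixed_eq_zero_of_gap hN (hgap _ (by linarith) le_rfl) (hgap _ le_rfl (by linarith))
      (hgap _ (by linarith) (by linarith)) (hgap _ (by linarith) (by linarith)) (by ring)
  -- Ψ = Ψ_wall − φ at the four nonnegative points
  rw [e1, e2, hx, e4, Real.dist_eq, sub_zero,
    zetaScrew_eq_wallPsi_sub_primeSum (show 0 ≤ ℓ + a by linarith [hℓ0.le]),
    zetaScrew_eq_wallPsi_sub_primeSum (show 0 ≤ ℓ - b from
      (Real.log_nonneg hN').trans (hgap _ le_rfl (by linarith)).1),
    zetaScrew_eq_wallPsi_sub_primeSum hℓ0.le,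
    zetaScrew_eq_wallPsi_sub_primeSum (show 0 ≤ ℓ + a - b from
      (Real.log_nonneg hN').trans (hgap _ (by linarith) (by linarith)).1)]
  have hΔ := hδW ℓ a b (by simp [hδ.le]) ha0 (hale.trans hrδ) hb0 (hble.trans hrδ)
  have hMa : ((2 * (N : ℝ) + 1) * r) * a ≤ 2 * (2 * N + 1) := by
    have h1 : ((2 * (N : ℝ) + 1) * r) * a ≤ ((2 * (N : ℝ) + 1) * r) * (1 / (r : ℝ)) :=
      mul_le_mul_of_nonneg_left hale hM0.le
    have h2 : ((2 * (N : ℝ) + 1) * r) * (1 / (r : ℝ)) = 2 * N + 1 := by field_simp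
    nlinarith
  have ekey : wallPsi (ℓ + a) - zetaScrewPrimeSum (ℓ + a) + (wallPsi (ℓ - b) - zetaScrewPrimeSum (ℓ - b))
      - (wallPsi ℓ - zetaScrewPrimeSum ℓ) - (wallPsi (ℓ + a - b) - zetaScrewPrimeSum (ℓ + a - b))
      = wallPsi (ℓ + a) + wallPsi (ℓ - b) - wallPsi ℓ - wallPsi (ℓ + a - b) := by
    linear_combination -hφ
  rw [ekey]
  calc |((2 * (N : ℝ) + 1) * r) * (wallPsi (ℓ + a) + wallPsi (ℓ - b) - wallPsi ℓ - wallPsi (ℓ + a - b))|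
      = ((2 * (N : ℝ) + 1) * r) * |wallPsi (ℓ + a) + wallPsi (ℓ - b) - wallPsi ℓ - wallPsi (ℓ + a - b)| := by
        rw [abs_mul, abs_of_pos hM0]
    _ ≤ ((2 * (N : ℝ) + 1) * r) * (ε / (4 * (2 * N + 1)) * a) := mul_le_mul_of_nonneg_left hΔ hM0.le
    _ = ε / (4 * (2 * N + 1)) * (((2 * (N : ℝ) + 1) * r) * a) := by ring
    _ ≤ ε / (4 * (2 * N + 1)) * (2 * (2 * N + 1)) := mul_le_mul_of_nonneg_left hMa (by positivity)
    _ = ε / 2 := by field_simp; ring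
    _ < ε := by linarith

end Summit.RiemannHypothesis.RiemannHypothesis.Theorems.IntegerScrew
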